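import Literature.Analysis.FluidPDE.CKNTheoremBReduction
import Literature.Analysis.FluidPDE.CKNLocalRegularityRRSPressure
import HarnessLib

/-!
# Caffarelli–Kohn–Nirenberg 1982, Theorem B (partial regularity) — discharged

Analysis/FluidPDE glue file **discharging the named fact
`Literature.Analysis.FluidPDE.ckn_partial_regularity`** (`PartialRegularity.lean`;
L. Caffarelli, R. Kohn, L. Nirenberg, *Partial regularity of suitable weak solutions of the
Navier–Stokes equations*, Comm. Pure Appl. Math. 35 (1982), Theorem B: "For any suitable weak
solution of the Navier–Stokes system on an open set in space–time, the associated singular set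
satisfies `𝒫¹(S) = 0`"). The accepted tree reduction is `ckn_partial_regularity_of_lemma15_12`
(`CKNTheoremBReduction.lean`: Theorem B from the first local regularity theorem with force,
Robinson–Rodrigo–Sadowski Thm. 15.3, itself reduced there to Lemma 15.12 through the proved Step 2),
and Lemma 15.12 is discharged (`RRS2016.lemma15_12_holds`, `CKNLocalRegularityRRSPressure.lean`).
Hence `ckn_partial_regularity_holds`; the same term is obtained from
`ckn_partial_regularity_of_theorem15_3_force RRS2016.theorem15_3_force_holds`.

Theorem-only glue module: no definitions, no named facts, no `sorry`; each theorem is a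
composition of an accepted tree reduction with accepted discharges (pure proof of an
unchanged statement).

## References

* L. Caffarelli, R. Kohn, L. Nirenberg, *Partial regularity of suitable weak solutions of the
  Navier–Stokes equations*, Comm. Pure Appl. Math. 35 (1982), 771–831, Theorem B. [CKN1982]
* F.-H. Lin, *A new proof of the Caffarelli–Kohn–Nirenberg theorem*, Comm. Pure Appl. Math. 51
  (1998), 241–257.
* J. C. Robinson, J. L. Rodrigo, W. Sadowski, *The Three-Dimensional Navier–Stokes Equations*,
  CUP (2016), Thm. 15.3, Lemma 15.12, Thm. 16.2. [RobinsonRodrigoSadowski2016]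
-/

noncomputable section

namespace Literature.Analysis.FluidPDE

/-- **Caffarelli–Kohn–Nirenberg 1982, Theorem B (`𝒫¹(S) = 0` for suitable weak solutions),
proved** (the named statement `ckn_partial_regularity`), by
`ckn_partial_regularity_of_lemma15_12` and `RRS2016.lemma15_12_holds`. [cite: CKN1982, Theorem B] -/
theorem ckn_partial_regularity_holds : ckn_partial_regularity :=
  ckn_partial_regularity_of_lemma15_12 RRS2016.lemma15_12_holds

end Literature.Analysis.FluidPDE
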